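import Summits.RiemannHypothesis.RiemannHypothesis.Theses.UniversalFactor
import Summits.RiemannHypothesis.RiemannHypothesis.Theorems.UniversalFactorLaguerreCriterion
import Mathlib.MeasureTheory.Integral.IntervalIntegral.Basic
import Summits.RiemannHypothesis.RiemannHypothesis.Theorems.UniversalFactorMediumKernelNoGoStubPhiPartialC
import Summits.RiemannHypothesis.RiemannHypothesis.Theorems.UniversalFactorMediumKernelNoGoStubPhiTailN
import Summits.RiemannHypothesis.RiemannHypothesis.Theorems.UniversalFactorMediumKernelNoGoStubQuadH
import Summits.RiemannHypothesis.RiemannHypothesis.Theorems.UniversalFactorMediumKernelNoGoStubPhiIoiTail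
import Summits.RiemannHypothesis.RiemannHypothesis.Theorems.UniversalFactorMediumKernelNoGoStubH0cosh

/-!
# Line `one-sided-average-sign-test` for the crux `UniversalFactor.MediumKernelNoGo`
(item stmt-RiemannHypothesis-2577, route route-RiemannHypothesis-UniversalFactor) — LEAD's reshaped skeleton

Crux (FIXED, concluded by name in `MediumKernelNoGo_of`):
`∀ a, π/8 ≤ a → a ≤ 32 → ¬ HasOnlyRealZeros F_a`, `F_a = deBruijnHDiv (1 + u²/a²)` = Laplace(a)-smoothing
of `H_0`.

The line: at ONE real point `x ≥ 0` per `a`, a FILLED DIP (`H_0(x) < 0 < P_a(x), Q_a(x)`) or a filled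
hump, where `P_a(x) = ∫₀^∞ H_0(x − y) e^{−ay} dy`, `Q_a(x) = ∫₀^∞ H_0(x + y) e^{−ay} dy`, exhibits a
non-real zero of `F_a` (tree theorems `UniversalFactor.not_hasOnlyRealZeros_of_dip_certificate` /
`_of_hump_certificate`, from Laguerre's inequality).  The continuum `a ∈ [π/8, 32]` is covered by
finitely many `a`-boxes; on a box `[a₁, a₂]` the one-sided averages are enclosed by certified
Gauss–Legendre quadrature in `y` of the holomorphic integrand `H_0(x ∓ w) e^{−aw}` with the node
weights `e^{−a y_j}` entered as the INTERVALS `[e^{−a₂ y_j}, e^{−a₁ y_j}]` (valid for every `a` in the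
box at once; no `max`-splitting, no kinks), the quadrature error from a sup bound on a disc
(`UniversalFactor.quadrature_error_le`, rotated to horizontal segments: `stub_quadH`), the tails from
`‖H_0(t)‖ ≤ H_0(0) = ∫Φ ≤ 1`.  The certified VALUES of `H_0` at the real nodes `x ∓ y_j` come from two evaluators:
* LOW window `a ∈ [π/8, 3/2]` (three hump points: `x = 64.6` on `[0.392698, 0.445757]` (4 boxes),
  `x = 222.8` on `[0.44, 0.706253]` (6), `x = 223.2` on `[0.7, 1.521472]` (9)): the Fourier integral
  `H_0(x') = ∫₀^∞ Φ(u) cos(x'u) du` by certified Gauss–Legendre quadrature in `u` of the finite theta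
  sum `Σ_{n<N} Φ_n(w) cos(x'w)` (entire; disc bound `stub_phiPartialC`), theta tail `stub_phiTailN`,
  `u`-tail `stub_phiIoiTail`, disc bound of `H_0` itself in the `y`-plane from the cosh-majorisation
  `stub_H0cosh` — tree files `UniversalFactorMedium{Defs,BoxDefs,LowDefs}.lean` (checker),
  `…Medium{UCells,UTables,UEval,YCells,YSums,Cover}.lean` (soundness, ending in `osaCoverCheck_sound`),
  `…MediumLowWindow{A,B,C}.lean` (one `native_decide` each), `…MediumLowWindow.lean` (`stub_lowWindow`);
* HIGH window `a ∈ [3/2, 32]` (Lehmer's dip `x = 14010.16`, ≈ 25 boxes): `H_0(2t) = −K₀ · Re core(½+it)·μ`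
  from certified `ζ(½+it)` and second-order Stirling (the stmt-2582 engine:
  `UniversalFactorLehmer{Defs,Representation,Quadrature,CoreBounds,Tails,Numerics}.lean`).
(Planning numerics, kit/plan2.py + kit/tside.py of the lead's folder: u-side hump certificates exist at
`x ≈ 223` up to `a ≈ 1.6` and Lehmer dip certificates from `a ≈ 1.24`; the split `3/2` lies in the
overlap and spares the t-side its expensive low-`a` end.)
Both windows end in a `Bool` checker run by `native_decide` (`--computational`), as in
`MertensCertificateBT2` / `DeBrangesPositivityCert`.

Registered stubs (7): five ANALYTIC worker stubs (`stub_H0cosh`, `stub_phiTailN`, `stub_phiPartialC`,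
`stub_phiIoiTail`, `stub_quadH`; sizes S–M, independent of each other) and two CERTIFIED-COMPUTATION
stubs held by the lead (`stub_lowWindow`, `stub_highWindow`; hypothesis-free — the analytic stubs are
consumed by the tree files proving them).  `MediumKernelNoGo_of` is the sorry-free composition.

Disproof.lean (cdisprove) honoured: `0 < a` is derived from `π/8 ≤ a` (its §2), certificate points are
at `x ≥ 0` (§4); no `_false_without_` theorem or `Negative/` lemma exists for this crux (2026-08-16).
-/

set_option linter.dupNamespace false

noncomputable section

open Complex MeasureTheory Set
open Literature.NumberTheory.LFunctions

namespace Summit.RiemannHypothesis.RiemannHypothesis.Cruxes.MediumKernelNoGo.OneSidedAverageSignTest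

open Summit.RiemannHypothesis.RiemannHypothesis.Theorems

/-! ## The seven stub STATEMENTS (named `Prop`s over existing declarations only) -/

/-- STUB 1 statement — cosh-majorisation of `H_0` off the real axis and an explicit strip constant:
`‖H_0(z)‖ ≤ ∫₀^∞ Φ(u) cosh(Im z · u) du` (from `H_0(z) = ∫₀^∞ Φ(u) cos(zu) du`, `Φ > 0`,
`|cos(zu)| ≤ cosh(Im z · u)`), the integrability of `Φ(u) cosh(12u)` on `(0,∞)`, and
`∫₀^∞ Φ(u) cosh(12u) du ≤ 5` (true value `H_0(12i) = ξ(6.5)/8 ≈ 0.14`; from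
`Φ(u) ≤ 50 e^{9u − πe^{4u}}`, `cosh(12u) ≤ e^{12u}`). -/
def H0CoshBound : Prop :=
  (∀ z : ℂ, ‖deBruijnH 0 z‖ ≤ ∫ u in Ioi (0:ℝ), deBruijnPhi u * Real.cosh (z.im * u)) ∧
  IntegrableOn (fun u : ℝ => deBruijnPhi u * Real.cosh (12 * u)) (Ioi 0) ∧
  (∫ u in Ioi (0:ℝ), deBruijnPhi u * Real.cosh (12 * u)) ≤ 5

/-- STUB 2 statement — explicit tail of the theta series of `Φ` on `[0,∞)`:
`0 ≤ Φ(u) − Σ_{n<N} Φ_n(u) ≤ 4π²(N+1)⁴ e^{9u} exp(−π(N+1)² e^{4u})` for `N ≥ 1`, `u ≥ 0`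
(all summands are positive on `[0,∞)`; the omitted ones are dominated by twice the first of them,
consecutive ratios being `≤ 16 e^{−3π}`). -/
def PhiTailN : Prop :=
  ∀ (N : ℕ) (u : ℝ), 1 ≤ N → 0 ≤ u →
    0 ≤ deBruijnPhi u - ∑ n ∈ Finset.range N, deBruijnPhiSummand n u ∧
    deBruijnPhi u - ∑ n ∈ Finset.range N, deBruijnPhiSummand n u ≤
      4 * Real.pi ^ 2 * ((N : ℝ) + 1) ^ 4 * Real.exp (9 * u) *
        Real.exp (-(Real.pi * ((N : ℝ) + 1) ^ 2 * Real.exp (4 * u)))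

/-- STUB 3 statement — the finite theta sum as an ENTIRE function with an explicit majorant:
`S_N(w) = Σ_{n<N} (2π²(n+1)⁴e^{9w} − 3π(n+1)²e^{5w}) exp(−π(n+1)²e^{4w})` is complex-differentiable,
restricts to `Σ_{n<N} Φ_n` on `ℝ`, and
`‖S_N(u+iv)‖ ≤ Σ_{n<N} (2π²(n+1)⁴e^{9u} + 3π(n+1)²e^{5u}) exp(−π(n+1)²e^{4u} cos 4v)`
(`|e^{s}| = e^{Re s}`, `Re(e^{4w}) = e^{4u} cos 4v`). -/
def PhiPartialC : Prop :=
  ∀ N : ℕ,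
    Differentiable ℂ (fun w : ℂ => ∑ n ∈ Finset.range N,
      (2 * (Real.pi : ℂ) ^ 2 * ((n : ℂ) + 1) ^ 4 * Complex.exp (9 * w)
          - 3 * (Real.pi : ℂ) * ((n : ℂ) + 1) ^ 2 * Complex.exp (5 * w)) *
        Complex.exp (-((Real.pi : ℂ) * ((n : ℂ) + 1) ^ 2 * Complex.exp (4 * w)))) ∧
    (∀ u : ℝ, (∑ n ∈ Finset.range N,
      (2 * (Real.pi : ℂ) ^ 2 * ((n : ℂ) + 1) ^ 4 * Complex.exp (9 * (u : ℂ))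
          - 3 * (Real.pi : ℂ) * ((n : ℂ) + 1) ^ 2 * Complex.exp (5 * (u : ℂ))) *
        Complex.exp (-((Real.pi : ℂ) * ((n : ℂ) + 1) ^ 2 * Complex.exp (4 * (u : ℂ))))) =
      ((∑ n ∈ Finset.range N, deBruijnPhiSummand n u : ℝ) : ℂ)) ∧
    (∀ w : ℂ, ‖∑ n ∈ Finset.range N,
      (2 * (Real.pi : ℂ) ^ 2 * ((n : ℂ) + 1) ^ 4 * Complex.exp (9 * w)
          - 3 * (Real.pi : ℂ) * ((n : ℂ) + 1) ^ 2 * Complex.exp (5 * w)) *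
        Complex.exp (-((Real.pi : ℂ) * ((n : ℂ) + 1) ^ 2 * Complex.exp (4 * w)))‖ ≤
      ∑ n ∈ Finset.range N,
        (2 * Real.pi ^ 2 * ((n : ℝ) + 1) ^ 4 * Real.exp (9 * w.re)
            + 3 * Real.pi * ((n : ℝ) + 1) ^ 2 * Real.exp (5 * w.re)) *
          Real.exp (-(Real.pi * ((n : ℝ) + 1) ^ 2 * Real.exp (4 * w.re) * Real.cos (4 * w.im))))

/-- STUB 4 statement — explicit `u`-tail of `Φ`: for `U ≥ 0`,
`∫_{u>U} Φ(u) du ≤ 50 e^{9U − πe^{4U}} / (4π e^{4U} − 9)`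
(`Φ(u) ≤ (Σ_n M_n) e^{9u−πe^{4u}}` with `Σ_n M_n = 5π² Σ_{m≥1} m⁴e^{−π(m²−1)} ≤ 50`, and
`9u − πe^{4u} ≤ 9U − πe^{4U} − (4πe^{4U} − 9)(u − U)` for `u ≥ U`). -/
def PhiIoiTail : Prop :=
  ∀ U : ℝ, 0 ≤ U →
    ∫ u in Ioi U, deBruijnPhi u ≤
      50 * Real.exp (9 * U - Real.pi * Real.exp (4 * U)) / (4 * Real.pi * Real.exp (4 * U) - 9)

/-- STUB 5 statement — certified quadrature along a HORIZONTAL segment (the rotation of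
`UniversalFactor.quadrature_error_le`): `f` holomorphic on `ball c R₁`, `‖f‖ ≤ M` on `sphere c R`,
`0 ≤ ρ < R < R₁`, nodes `|u j| ≤ ρ`, real weights; then for every `K`
`‖∫_{−ρ}^{ρ} f(c + x) dx − Σ_j W_j f(c + u_j)‖ ≤ M · (Σ_{n≤K} η_n/Rⁿ + (2ρ + Σ_j |W_j|) q^{K+1}/(1−q))`,
`q = ρ/R`, `η_n` the defect of the rule on `xⁿ` (the bracket is `UniversalFactor.quadDefect s u W ρ R K`
of `UniversalFactorLehmerDefs.lean`, inlined here to keep the skeleton's imports minimal). -/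
def QuadratureH : Prop :=
  ∀ (f : ℂ → ℂ) (c : ℂ) (R R₁ ρ M : ℝ), 0 ≤ ρ → ρ < R → R < R₁ →
    DifferentiableOn ℂ f (Metric.ball c R₁) → (∀ z ∈ Metric.sphere c R, ‖f z‖ ≤ M) →
    ∀ (s : Finset ℕ) (u W : ℕ → ℝ), (∀ j ∈ s, |u j| ≤ ρ) → ∀ K : ℕ,
      ‖(∫ x in (-ρ)..ρ, f (c + (x : ℂ))) - ∑ j ∈ s, (W j : ℂ) * f (c + (u j : ℂ))‖ ≤
        M * (∑ n ∈ Finset.range (K + 1),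
              |((ρ ^ (n + 1) - (-ρ) ^ (n + 1)) / (n + 1) - ∑ j ∈ s, W j * u j ^ n)| / R ^ n
           + (2 * ρ + ∑ j ∈ s, |W j|) * ((ρ / R) ^ (K + 1) / (1 - ρ / R)))

/-- STUB 6 statement — the LOW WINDOW (certified computation on the `u`-side at three hump points,
`x = 64.6` (`a ∈ [0.392698, 0.445757]`), `x = 222.8` (`[0.44, 0.706253]`) and `x = 223.2`
(`[0.7, 1.521472]`), i.e. between the `H_0`-zeros `2γ₄, 2γ₅` and inside the close pair
`2γ = 222.06, 223.75`): every `a ∈ [π/8, 3/2]` has a point `x ≥ 0` carrying a filled dip or a filled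
hump of the one-sided Laplace(a) averages of `H_0`.  (The five analytic stubs are consumed inside the
tree files that prove it; the statement itself is hypothesis-free.) -/
def LowWindow : Prop :=
  ∀ a : ℝ, Real.pi / 8 ≤ a → a ≤ 3 / 2 → ∃ x : ℝ, 0 ≤ x ∧
    (((deBruijnH 0 x).re < 0 ∧
      0 < (∫ y in Ioi (0:ℝ), deBruijnH 0 ((x : ℂ) - y) * (Real.exp (-(a * y)) : ℂ)).re ∧
      0 < (∫ y in Ioi (0:ℝ), deBruijnH 0 ((x : ℂ) + y) * (Real.exp (-(a * y)) : ℂ)).re) ∨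
     (0 < (deBruijnH 0 x).re ∧
      (∫ y in Ioi (0:ℝ), deBruijnH 0 ((x : ℂ) - y) * (Real.exp (-(a * y)) : ℂ)).re < 0 ∧
      (∫ y in Ioi (0:ℝ), deBruijnH 0 ((x : ℂ) + y) * (Real.exp (-(a * y)) : ℂ)).re < 0))

/-- STUB 7 statement — the HIGH WINDOW (certified computation on the `t`-side at Lehmer's pair,
`x = 14010.16`, `a ∈ [3/2, 32]`, ≈ 25 boxes): every `a ∈ [3/2, 32]` has a point `x ≥ 0` with
`H_0(x) < 0` and both one-sided Laplace(a) averages of `H_0` at `x` positive. -/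
def HighWindow : Prop :=
  ∀ a : ℝ, 3 / 2 ≤ a → a ≤ 32 → ∃ x : ℝ, 0 ≤ x ∧ (deBruijnH 0 x).re < 0 ∧
    0 < (∫ y in Ioi (0:ℝ), deBruijnH 0 ((x : ℂ) - y) * (Real.exp (-(a * y)) : ℂ)).re ∧
    0 < (∫ y in Ioi (0:ℝ), deBruijnH 0 ((x : ℂ) + y) * (Real.exp (-(a * y)) : ℂ)).re

/-! ## The registered stubs (`sorry` lives only in these seven theorems; bodies VERBATIM) -/

/-- **STUB 1 · `stub_H0cosh`** (analytic, size M) — `‖H_0(z)‖ ≤ ∫₀^∞ Φ(u) cosh(Im z·u) du` for all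
complex `z`; `Φ(u)cosh(12u)` integrable on `(0,∞)`; `∫₀^∞ Φ(u)cosh(12u) du ≤ 5`.  Leans on:
`deBruijnH` at `t = 0` is `∫₀^∞ Φ(u) cos(zu) du` (definition / `deBruijnH_zero_eq_integral_cos`),
`deBruijnPhi_pos_of_nonneg`, `abs_deBruijnPhi_le` + `summable_deBruijnPhiMajorant`
(`DeBruijnNewmanProofs.lean`; the worker bounds `∑' deBruijnPhiMajorant ≤ 50`),
`norm_integral_le_of_norm_le`, `|cos(a+ib)|² = cosh² b − sin² a`. -/
theorem stub_H0cosh :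
    (∀ z : ℂ, ‖deBruijnH 0 z‖ ≤ ∫ u in Ioi (0:ℝ), deBruijnPhi u * Real.cosh (z.im * u)) ∧
    IntegrableOn (fun u : ℝ => deBruijnPhi u * Real.cosh (12 * u)) (Ioi 0) ∧
    (∫ u in Ioi (0:ℝ), deBruijnPhi u * Real.cosh (12 * u)) ≤ 5 := by
  exact _root_.Summit.RiemannHypothesis.RiemannHypothesis.Theorems.UniversalFactor.stub_H0cosh

/-- **STUB 2 · `stub_phiTailN`** (analytic, size S/M) — explicit theta-series tail of `Φ` on `[0,∞)`.
Leans on: `deBruijnPhi` is the `tsum` of `deBruijnPhiSummand` (`summable_deBruijnPhi_holds`),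
`deBruijnPhiSummand_pos`, `sum_add_tsum_nat_add`, a geometric comparison with ratio `≤ 1/2`. -/
theorem stub_phiTailN :
    ∀ (N : ℕ) (u : ℝ), 1 ≤ N → 0 ≤ u →
    0 ≤ deBruijnPhi u - ∑ n ∈ Finset.range N, deBruijnPhiSummand n u ∧
    deBruijnPhi u - ∑ n ∈ Finset.range N, deBruijnPhiSummand n u ≤
      4 * Real.pi ^ 2 * ((N : ℝ) + 1) ^ 4 * Real.exp (9 * u) *
        Real.exp (-(Real.pi * ((N : ℝ) + 1) ^ 2 * Real.exp (4 * u))) := by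
  exact _root_.Summit.RiemannHypothesis.RiemannHypothesis.Theorems.UniversalFactor.stub_phiTailN

/-- **STUB 3 · `stub_phiPartialC`** (analytic, size S/M) — the finite theta sum is entire, restricts
to `Σ_{n<N} Φ_n` on `ℝ`, and obeys the explicit majorant on horizontal lines.  Leans on:
`Differentiable.cexp`, `Complex.ofReal_exp`, `Complex.norm_exp`, `Complex.exp_re`,
`norm_sum_le`, `norm_sub_le`. -/
theorem stub_phiPartialC :
    ∀ N : ℕ,
    Differentiable ℂ (fun w : ℂ => ∑ n ∈ Finset.range N,
      (2 * (Real.pi : ℂ) ^ 2 * ((n : ℂ) + 1) ^ 4 * Complex.exp (9 * w)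
          - 3 * (Real.pi : ℂ) * ((n : ℂ) + 1) ^ 2 * Complex.exp (5 * w)) *
        Complex.exp (-((Real.pi : ℂ) * ((n : ℂ) + 1) ^ 2 * Complex.exp (4 * w)))) ∧
    (∀ u : ℝ, (∑ n ∈ Finset.range N,
      (2 * (Real.pi : ℂ) ^ 2 * ((n : ℂ) + 1) ^ 4 * Complex.exp (9 * (u : ℂ))
          - 3 * (Real.pi : ℂ) * ((n : ℂ) + 1) ^ 2 * Complex.exp (5 * (u : ℂ))) *
        Complex.exp (-((Real.pi : ℂ) * ((n : ℂ) + 1) ^ 2 * Complex.exp (4 * (u : ℂ))))) =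
      ((∑ n ∈ Finset.range N, deBruijnPhiSummand n u : ℝ) : ℂ)) ∧
    (∀ w : ℂ, ‖∑ n ∈ Finset.range N,
      (2 * (Real.pi : ℂ) ^ 2 * ((n : ℂ) + 1) ^ 4 * Complex.exp (9 * w)
          - 3 * (Real.pi : ℂ) * ((n : ℂ) + 1) ^ 2 * Complex.exp (5 * w)) *
        Complex.exp (-((Real.pi : ℂ) * ((n : ℂ) + 1) ^ 2 * Complex.exp (4 * w)))‖ ≤
      ∑ n ∈ Finset.range N,
        (2 * Real.pi ^ 2 * ((n : ℝ) + 1) ^ 4 * Real.exp (9 * w.re)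
            + 3 * Real.pi * ((n : ℝ) + 1) ^ 2 * Real.exp (5 * w.re)) *
          Real.exp (-(Real.pi * ((n : ℝ) + 1) ^ 2 * Real.exp (4 * w.re) * Real.cos (4 * w.im)))) := by
  exact _root_.Summit.RiemannHypothesis.RiemannHypothesis.Theorems.UniversalFactor.stub_phiPartialC

/-- **STUB 4 · `stub_phiIoiTail`** (analytic, size S/M) — explicit `u`-tail of `Φ`.  Leans on:
`abs_deBruijnPhi_le`, `summable_deBruijnPhiMajorant` (bound `∑' deBruijnPhiMajorant ≤ 50`),
`integral_exp_neg_Ioi`-type evaluation, `setIntegral_mono_on`, `integrableOn_deBruijnPhi`. -/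
theorem stub_phiIoiTail :
    ∀ U : ℝ, 0 ≤ U →
    ∫ u in Ioi U, deBruijnPhi u ≤
      50 * Real.exp (9 * U - Real.pi * Real.exp (4 * U)) / (4 * Real.pi * Real.exp (4 * U) - 9) := by
  exact _root_.Summit.RiemannHypothesis.RiemannHypothesis.Theorems.UniversalFactor.stub_phiIoiTail

/-- **STUB 5 · `stub_quadH`** (analytic, size S) — quadrature error along a horizontal segment, by
applying `UniversalFactor.quadrature_error_le` to the rotated function `g w = f (c − I (w − c))`
(`g (c + xI) = f (c + x)`; rotation preserves `ball c R₁` and `sphere c R`). -/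
theorem stub_quadH :
    ∀ (f : ℂ → ℂ) (c : ℂ) (R R₁ ρ M : ℝ), 0 ≤ ρ → ρ < R → R < R₁ →
    DifferentiableOn ℂ f (Metric.ball c R₁) → (∀ z ∈ Metric.sphere c R, ‖f z‖ ≤ M) →
    ∀ (s : Finset ℕ) (u W : ℕ → ℝ), (∀ j ∈ s, |u j| ≤ ρ) → ∀ K : ℕ,
      ‖(∫ x in (-ρ)..ρ, f (c + (x : ℂ))) - ∑ j ∈ s, (W j : ℂ) * f (c + (u j : ℂ))‖ ≤
        M * (∑ n ∈ Finset.range (K + 1),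
              |((ρ ^ (n + 1) - (-ρ) ^ (n + 1)) / (n + 1) - ∑ j ∈ s, W j * u j ^ n)| / R ^ n
           + (2 * ρ + ∑ j ∈ s, |W j|) * ((ρ / R) ^ (K + 1) / (1 - ρ / R))) := by
  exact _root_.Summit.RiemannHypothesis.RiemannHypothesis.Theorems.UniversalFactor.stub_quadH

/-- **STUB 6 · `stub_lowWindow`** (certified computation, size L — held by the lead) — the low
window `a ∈ [π/8, 3/2]`: a `Bool` checker (interval arithmetic
`Literature.Analysis.ValidatedNumerics.NumericsMP`, scale `2^256`; definitions
`Theorems/UniversalFactorMediumDefs.lean`, `…MediumBoxDefs.lean`, `…MediumLowDefs.lean`) encloses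
`H_0` at the real `y`-nodes `|x ∓ y|` of a point `x` by certified Gauss–Legendre quadrature of the
Fourier integral `∫₀^∞ Φ(u) cos(x'u) du` (theta sum to 6 terms, `stub_phiTailN/PartialC/IoiTail`,
`stub_quadH`), forms the interval-weighted (`[e^{−a₂y}, e^{−a₁y}]`) `y`-sums per `a`-box, adds the
certified `y`-quadrature (`stub_H0cosh`: `‖H_0‖ ≤ 5` for `|Im| ≤ 12`) and tail errors, and checks the
hump signs on covers of three windows (points `x = 64.6, 222.8, 223.2`; 4 + 6 + 9 boxes); soundness
`osaCoverCheck_sound` (`…MediumCover.lean`) + one `native_decide` per window. -/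
theorem stub_lowWindow :
    ∀ a : ℝ, Real.pi / 8 ≤ a → a ≤ 3 / 2 → ∃ x : ℝ, 0 ≤ x ∧
    (((deBruijnH 0 x).re < 0 ∧
      0 < (∫ y in Ioi (0:ℝ), deBruijnH 0 ((x : ℂ) - y) * (Real.exp (-(a * y)) : ℂ)).re ∧
      0 < (∫ y in Ioi (0:ℝ), deBruijnH 0 ((x : ℂ) + y) * (Real.exp (-(a * y)) : ℂ)).re) ∨
     (0 < (deBruijnH 0 x).re ∧
      (∫ y in Ioi (0:ℝ), deBruijnH 0 ((x : ℂ) - y) * (Real.exp (-(a * y)) : ℂ)).re < 0 ∧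
      (∫ y in Ioi (0:ℝ), deBruijnH 0 ((x : ℂ) + y) * (Real.exp (-(a * y)) : ℂ)).re < 0)) := by
  sorry

/-- **STUB 7 · `stub_highWindow`** (certified computation, size L — held by the lead) — the high
window `a ∈ [3/2, 32]` at Lehmer's dip `x = 14010.16` (≈ 25 boxes): `H_0(x) < 0` and both one-sided
averages positive for all `a` of each box (the stmt-2582 `ζ`+Stirling representation
`deBruijnH_zero_two_mul_repr` at Gauss–Legendre `t`-nodes, interval weights `e^{−2aτ}`, disc bound
`norm_lehmerF_le_of_mem_sphere`, tails in the style of `lehmer_tail_P/Q` for general `a`);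
soundness + `native_decide`. -/
theorem stub_highWindow :
    ∀ a : ℝ, 3 / 2 ≤ a → a ≤ 32 → ∃ x : ℝ, 0 ≤ x ∧ (deBruijnH 0 x).re < 0 ∧
    0 < (∫ y in Ioi (0:ℝ), deBruijnH 0 ((x : ℂ) - y) * (Real.exp (-(a * y)) : ℂ)).re ∧
    0 < (∫ y in Ioi (0:ℝ), deBruijnH 0 ((x : ℂ) + y) * (Real.exp (-(a * y)) : ℂ)).re := by
  sorry

/-! ### Consistency: each named statement IS its registered stub (definitionally) -/

theorem h0CoshBound_holds : H0CoshBound := stub_H0cosh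
theorem phiTailN_holds : PhiTailN := stub_phiTailN
theorem phiPartialC_holds : PhiPartialC := stub_phiPartialC
theorem phiIoiTail_holds : PhiIoiTail := stub_phiIoiTail
theorem quadratureH_holds : QuadratureH := stub_quadH
theorem lowWindow_holds : LowWindow := stub_lowWindow
theorem highWindow_holds : HighWindow := stub_highWindow

/-! ### Name-keyed aliases of the statements (the hypotheses of the composition) -/
namespace Registered

/-- Alias of `H0CoshBound` keyed by the registered stub name. -/
abbrev stub_H0cosh : Prop := H0CoshBound
/-- Alias of `PhiTailN` keyed by the registered stub name. -/
abbrev stub_phiTailN : Prop := PhiTailN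
/-- Alias of `PhiPartialC` keyed by the registered stub name. -/
abbrev stub_phiPartialC : Prop := PhiPartialC
/-- Alias of `PhiIoiTail` keyed by the registered stub name. -/
abbrev stub_phiIoiTail : Prop := PhiIoiTail
/-- Alias of `QuadratureH` keyed by the registered stub name. -/
abbrev stub_quadH : Prop := QuadratureH
/-- Alias of `LowWindow` keyed by the registered stub name. -/
abbrev stub_lowWindow : Prop := LowWindow
/-- Alias of `HighWindow` keyed by the registered stub name. -/
abbrev stub_highWindow : Prop := HighWindow

end Registered

/-! ## Proved glue -/

/-- `π/8 < 3/2` (so the low window is a genuine interval and `0 < a` on the crux's range). -/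
theorem pi_div_eight_lt : Real.pi / 8 < 3 / 2 := by
  have h := Real.pi_le_four
  linarith

/-! ## The composition: the seven stubs imply the crux, BY NAME (kernel-checked; no `sorry` below) -/

/-- **`MediumKernelNoGo_of`** — the skeleton theorem of the line.  Given `a ∈ [π/8, 32]`: if
`a ≤ 3/2` the low window gives a point `x ≥ 0` with a filled dip or hump of the one-sided Laplace(a)
averages, else the high window gives a filled dip (the five analytic stubs, all landed, are consumed by
the tree files proving the two windows and no longer appear as hypotheses); the tree's
certificate theorems (`UniversalFactor.not_hasOnlyRealZeros_of_dip_certificate` /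
`_of_hump_certificate`) give a non-real zero of `F_a = deBruijnHDiv (1 + u²/a²)`, which is the crux's
inline integral definitionally. -/
theorem MediumKernelNoGo_of (hL : Registered.stub_lowWindow) (hH : Registered.stub_highWindow) :
    Summit.RiemannHypothesis.RiemannHypothesis.Theses.UniversalFactor.MediumKernelNoGo := by
  intro a ha h32
  have hπ := pi_div_eight_lt
  have ha0 : 0 < a := lt_of_lt_of_le (by positivity) ha
  by_cases h1 : a ≤ 3 / 2
  · -- the low window `π/8 ≤ a ≤ 3/2`
    obtain ⟨x, hx0, hcert⟩ := hL a ha h1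
    rcases hcert with ⟨hHx, hP, hQ⟩ | ⟨hHx, hP, hQ⟩
    · exact UniversalFactor.not_hasOnlyRealZeros_of_dip_certificate ha0 hx0 hHx hP hQ
    · exact UniversalFactor.not_hasOnlyRealZeros_of_hump_certificate ha0 hx0 hHx hP hQ
  · -- the high window `3/2 < a ≤ 32`
    push Not at h1
    obtain ⟨x, hx0, hHx, hP, hQ⟩ := hH a h1.le h32
    exact UniversalFactor.not_hasOnlyRealZeros_of_dip_certificate ha0 hx0 hHx hP hQ

/-- Wiring check: the registered stubs feed `MediumKernelNoGo_of` as stated. -/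
example : Summit.RiemannHypothesis.RiemannHypothesis.Theses.UniversalFactor.MediumKernelNoGo :=
  MediumKernelNoGo_of stub_lowWindow stub_highWindow

end Summit.RiemannHypothesis.RiemannHypothesis.Cruxes.MediumKernelNoGo.OneSidedAverageSignTest

end
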